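import Mathlib
import Literature.NumberTheory.Automorphic.BianchiMaassCuspForms
import HarnessLib

/-!
# Hilbert modular forms of weight `(k_σ)_σ` over a totally real field: level subgroups of
# `SL₂(𝓞 F)`, the analytic definition on `ℍ^{Hom(F,ℝ)}`, and `q`-expansions at the cusp `∞`

Requested by route `Langlands/CapacityClassicality` (DEFINITION REQUEST `HilbertModularFormQExpansion`
of its thesis; needed to TYPE the rank-4 crux `HilbertIntegralOverconvergentIsCongruence`,
stmt-Langlands-8485, which is "untyped until `HilbertModularFormQExpansion` lands"): an analytic notion
of Hilbert modular form of arbitrary integral weight vector `k = (k_σ)_{σ : F →+* ℝ}` (non-parallel and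
partial weight one allowed) and level a subgroup `Γ ≤ SL₂(𝓞 F)` (typically `Γ₁(𝔫)`), together with the
Fourier coefficients `a_ν`, `ν ∈ F`, of an `𝓞 F`-periodic holomorphic function on the tube domain and
the `q`-expansion `ν ↦ a_ν` at the standard cusp, so that one can STATE "a given series
`∑_ν c(ν) q^ν`, `c : F → ℂ`, is the `q`-expansion of a Hilbert modular form of weight `k` and level
`Γ₁(𝔪)`".  The design follows the tree's genus-2 file `HilbertSiegelModularFormModN.lean` (van der
Geer's cube integral in integral-basis coordinates) one genus down, and Freitag's Chapter I.

Throughout `F` is a number field (intended totally real: then `F →+* ℝ` has `[F:ℚ]` elements and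
`ℍ^{Hom(F,ℝ)}` is Freitag's `ℍⁿ`; for `F = ℚ` everything is the classical picture on one upper half
plane), `𝓞 F` its ring of integers, `SL(2, R) = Matrix.SpecialLinearGroup (Fin 2) R`.

## Contents

* §1 Level structure: the congruence subgroups `Γ₀(𝔫)`, `Γ₁(𝔫)`, `Γ(𝔫)` of `SL(2, R)` over any
  commutative ring are the tree's `Bianchi.Gamma0`, `Bianchi.Gamma1`, `Bianchi.Gamma`
  (`BianchiMaassCuspForms.lean` §5), reused for `R = 𝓞 F` (cf. [Shimura1978HilbertSpecialValues] for
  the Hilbert modular setting with weight vectors `k ∈ ℤ^{Hom(F,ℝ)}` and level `Γ₁`-type groups).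
* §2 The analytic objects [Freitag1990, Ch. I §3 Def. 3.1, §4]: points `z = (z_σ)_σ` of
  `ℂ^{Hom(F,ℝ)}`, the half space `ℍ = {Im z_σ > 0 ∀σ}` (`halfSpace`), the action
  `(g z)_σ = (σ(a) z_σ + σ(b)) / (σ(c) z_σ + σ(d))` of `g ∈ SL₂(F)` through the real embeddings
  (`moeb`), the automorphy factor `J_k(g, z) = ∏_σ (σ(c) z_σ + σ(d))^{k_σ}` of integral weight
  `k : (F →+* ℝ) → ℤ` (`autFactor`; Freitag's `N(cz+d)^{2r}` is `k = 2r`), the weight-`k` slash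
  `(f|_k g)(z) = J_k(g,z)⁻¹ f(gz)` (`slash`), holomorphy = `ℂ`-Fréchet differentiability on the open
  set `ℍ` of the `Pi` normed space (`IsHolomorphicOn`), boundedness at `∞`
  (`IsBoundedAtInfty`: bounded on `{Im z_σ ≥ A ∀σ}` for some `A`), and the `ℂ`-vector space
  `HilbertModular.modularForms Γ k` of **Hilbert modular forms** [Freitag1990, Ch. I Def. 4.5]:
  holomorphic `f : ℍ → ℂ` with `f(γz) = J_k(γ,z) f(z)` for `γ ∈ Γ ≤ SL₂(𝓞 F)` that are REGULAR AT
  ALL CUSPS — here: `f|_k g` bounded at `∞` for every `g ∈ SL₂(F)` (Freitag's condition b) with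
  `G = SL(2, K)`, p. 44; for `[F:ℚ] ≥ 2` it is automatic by the Götzky–Koecher principle
  [Freitag1990, Ch. I Prop. 4.9 and Cor.], for `F = ℚ` it is Mathlib's `IsBoundedAtImInfty` at all
  cusps) — extended by `0` off `ℍ` so that `modularForms Γ k` is an honest `Submodule ℂ`.
  Products: `IsModularForm.mul` (weights add).
* §3 Fourier coefficients and `q`-expansions at the cusp `∞` [Freitag1990, Ch. I Lemma 4.1,
  Def. 4.3]: for an `𝓞 F`-periodic `f` the coefficient
  `a_ν(y) = ∫_{[0,1]^{[F:ℚ]}} f(x + iy) e^{-2πi S(ν(x+iy))} dx` in the coordinates `x = ∑_i x_i b_i`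
  of the integral basis `b = NumberField.integralBasis F` (a fundamental parallelotope of the
  translation lattice `𝓞 F` of volume `1` in these coordinates, so Freitag's `vol(P)⁻¹` is absent),
  at every height `y ≫ 0` (`fourierCoeffAt`; independent of `y` for holomorphic `f`, Freitag 4.1 —
  a theorem, not part of this file) and at `y = 1` (`fourierCoeff`); the pairing
  `S(νz) = ∑_σ σ(ν) z_σ` (`pairing`); the index set `{0} ∪ {ν ≫ 0}` inside the dual lattice
  `𝔡⁻¹ = {ν : Tr(ν 𝓞_F) ⊆ ℤ}` (`qIndexSet`; by Koecher resp. regularity only these carry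
  coefficients [Freitag1990, Ch. I Def. 4.3]); and `qExpansion f : F → ℂ`, the coefficient function
  extended by `0` off the index set.

## Design notes

* Level subgroups live in `SL₂(𝓞 F)` and act through `SL₂(𝓞 F) → SL₂(F) ↪ SL₂(ℝ)^{Hom(F,ℝ)}`: this
  is the PRINCIPAL component of the Hilbert modular variety (the component of the standard cusp),
  which is where the `q`-expansion at `∞` of the crux lives; the adelic / `GL₂⁺`-components indexed by
  the narrow class group are not modelled.
* Weights are arbitrary `k ∈ ℤ^{Hom(F,ℝ)}` (no parity condition is imposed; if `-1 ∈ Γ` and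
  `∑_σ k_σ` is odd the space is simply `0`).  `J_k` uses `zpow`, so negative `k_σ` are allowed; on `ℍ`
  the bases `σ(c) z_σ + σ(d)` are non-zero (`denom_ne_zero`).
* The cusp condition is imposed at EVERY cusp through `SL₂(F)` (all cusps of a congruence subgroup
  are `SL₂(F)`-translates of `∞` up to the finitely many of `SL₂(𝓞 F)`; quantifying over all of
  `SL₂(F)` is harmless and basis-free).  The translation lattice of `g Γ g⁻¹` at `∞` is commensurable
  with `𝓞 F`; `fourierCoeffAt` is meaningful for any `𝓞 F`-periodic function (level `Γ ⊇ Γ₁(𝔫)`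
  at the standard cusp), junk otherwise.
* `q`-expansions are plain functions `F → ℂ`; a user's series `ν ↦ c(ν)` needs no membership proofs.
* This file is FACT-FREE (no named `def … : Prop` hypotheses): the comparison theorems (Fourier
  EXPANSION `f(z) = ∑ a_ν e^{2πi S(νz)}` and independence of `a_ν(y) e^{2π S(νy)}` of `y`, Freitag
  I.4.1; the `q`-expansion principle; Götzky–Koecher, Freitag I.4.9; finite dimensionality) are
  deliberately NOT stated here, so that importing routes keep a clean cone.

## What is not here

Overconvergent / `p`-adic Hilbert modular forms (Andreatta–Iovita–Pilloni, Kisin–Lai: these need the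
integral models of the Hilbert modular variety and are the subject of a separate request — a crux over
them is typed today with a Katz-expansion SURROGATE hypothesis, as the route does over `ℚ`);
half-integral or rational weights and multiplier systems [Freitag1990, p. 44]; Hecke operators; cusp
forms and the Petersson product; the non-principal components; integral structures `M_k(Γ; R)`.
-/

open scoped Matrix

namespace Literature.NumberTheory.Automorphic

open _root_.MeasureTheory _root_.NumberField MatrixGroups

namespace HilbertModular

/-! ## §1 Level subgroups of `SL₂` over a commutative ring

The congruence subgroups of `SL(2, R)` for an ideal `𝔫` of a commutative ring `R` are ALREADY in the
tree (file `BianchiMaassCuspForms.lean`, §5, stated for any commutative ring): `Bianchi.Gamma0 𝔫`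
(`c ∈ 𝔫`), `Bianchi.Gamma1 𝔫` (`c ∈ 𝔫`, `d ≡ 1 (mod 𝔫)`, hence `a ≡ 1`), `Bianchi.Gamma 𝔫` (the kernel
of `SL₂(R) → SL₂(R ⧸ 𝔫)`), with `Bianchi.Gamma_le_Gamma1`, `Bianchi.Gamma1_le_Gamma0`; they are reused
here for `R = 𝓞 F` (typical level of a Hilbert modular form below: `Bianchi.Gamma1 𝔫`,
`𝔫 : Ideal (𝓞 F)`), and not re-declared. -/


/-! ## §2 The half space `ℍ^{Hom(F,ℝ)}`, the action of `SL₂(F)`, and Hilbert modular forms -/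

section Analytic

variable (F : Type*) [Field F] [NumberField F]

/-- Points of the ambient space `ℂ^{Hom(F,ℝ)}` (`= F ⊗_ℚ ℂ` for `F` totally real): one complex
coordinate `z_σ` for each real embedding `σ`. [cite: Freitag1990, Ch. I §3] -/
abbrev Point : Type _ := (F →+* ℝ) → ℂ

/-- The product of upper half planes `ℍ = {z : Im z_σ > 0 for all σ}`. [cite: Freitag1990, Ch. I §3] -/
def halfSpace : Set (Point F) :=
  {z | ∀ σ, 0 < (z σ).im}

variable {F}

omit [NumberField F] in
/-- Membership in `ℍ`. [cite: Freitag1990, Ch. I §3] -/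
theorem mem_halfSpace_iff {z : Point F} : z ∈ halfSpace F ↔ ∀ σ, 0 < (z σ).im :=
  Iff.rfl

/-- `ℍ` is open in `ℂ^{Hom(F,ℝ)}`. [folklore] -/
theorem isOpen_halfSpace : IsOpen (halfSpace F) := by
  have : halfSpace F = ⋂ σ, {z : Point F | 0 < (z σ).im} := by
    ext z; simp [mem_halfSpace_iff]
  rw [this]
  exact isOpen_iInter_of_finite fun σ ↦
    isOpen_lt continuous_const (Complex.continuous_im.comp (continuous_apply σ))

/-- The denominator `σ(c) z_σ + σ(d)` of the action of `g = (a b; c d) ∈ SL₂(F)` at the embedding `σ`.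
[cite: Freitag1990, Ch. I §4] -/
def denom (g : SL(2, F)) (z : Point F) (σ : F →+* ℝ) : ℂ :=
  (σ (g 1 0) : ℂ) * z σ + (σ (g 1 1) : ℂ)

/-- The action of `g = (a b; c d) ∈ SL₂(F)` on `ℂ^{Hom(F,ℝ)}` through the real embeddings:
`(g z)_σ = (σ(a) z_σ + σ(b)) / (σ(c) z_σ + σ(d))` (junk where the denominator vanishes, which does
not happen on `ℍ`). [cite: Freitag1990, Ch. I §3] -/
noncomputable def moeb (g : SL(2, F)) (z : Point F) : Point F := fun σ ↦
  ((σ (g 0 0) : ℂ) * z σ + (σ (g 0 1) : ℂ)) / denom g z σ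

/-- The automorphy factor of integral weight `k = (k_σ)_σ`:
`J_k(g, z) = ∏_σ (σ(c) z_σ + σ(d))^{k_σ}` (Freitag's `N(cz+d)^{2r}` for `k = 2r`; integral powers,
`zpow`). [cite: Freitag1990, Ch. I §4] -/
noncomputable def autFactor (k : (F →+* ℝ) → ℤ) (g : SL(2, F)) (z : Point F) : ℂ :=
  ∏ σ, denom g z σ ^ (k σ)

/-- The weight-`k` slash action of `g ∈ SL₂(F)` on functions: `(f|_k g)(z) = J_k(g, z)⁻¹ f(g z)`
(Freitag's `f_A(z) = 𝓘(A⁻¹, z)⁻¹ f(A⁻¹ z)` is `f|_k A⁻¹`). [cite: Freitag1990, Ch. I §4 (4.3–4.4)] -/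
noncomputable def slash (k : (F →+* ℝ) → ℤ) (g : SL(2, F)) (f : Point F → ℂ) : Point F → ℂ :=
  fun z ↦ (autFactor k g z)⁻¹ * f (moeb g z)

/-- `SL₂(𝓞 F) → SL₂(F)` (the Hilbert modular group inside `SL₂(F)`). [cite: Freitag1990, Ch. I Def. 3.1] -/
noncomputable abbrev toSL2F : SL(2, 𝓞 F) →* SL(2, F) :=
  Matrix.SpecialLinearGroup.map (algebraMap (𝓞 F) F)

omit [NumberField F] in
/-- On `ℍ` the denominators do not vanish: if `σ(c) ≠ 0` the imaginary part of `σ(c) z_σ + σ(d)`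
is `σ(c) Im z_σ ≠ 0`, and if `c = 0` then `d ≠ 0` as `ad = 1`. [cite: Freitag1990, Ch. I §4] -/
theorem denom_ne_zero (g : SL(2, F)) {z : Point F} (hz : z ∈ halfSpace F) (σ : F →+* ℝ) :
    denom g z σ ≠ 0 := by
  intro h
  have him : (denom g z σ).im = σ (g 1 0) * (z σ).im := by
    simp [denom, Complex.add_im, Complex.mul_im]
  rw [h, Complex.zero_im] at him
  have hc : σ (g 1 0) = 0 := by
    rcases mul_eq_zero.1 him.symm with hc | hz0
    · exact hc
    · exact absurd hz0 (hz σ).ne'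
  have hc0 : g 1 0 = 0 := (map_eq_zero σ).1 hc
  have hdet := Matrix.det_fin_two (g : Matrix (Fin 2) (Fin 2) F)
  rw [g.det_coe, hc0, mul_zero, sub_zero] at hdet
  have hd : g 1 1 ≠ 0 := fun hd ↦ by rw [hd, mul_zero] at hdet; exact one_ne_zero hdet
  have hre : (denom g z σ).re = σ (g 1 1) := by
    simp [denom, hc]
  rw [h, Complex.zero_re] at hre
  exact hd ((map_eq_zero σ).1 hre.symm)

/-- `J_k(g, z) ≠ 0` on `ℍ`. [cite: Freitag1990, Ch. I §4] -/
theorem autFactor_ne_zero (k : (F →+* ℝ) → ℤ) (g : SL(2, F)) {z : Point F} (hz : z ∈ halfSpace F) :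
    autFactor k g z ≠ 0 :=
  Finset.prod_ne_zero_iff.2 fun σ _ ↦ zpow_ne_zero _ (denom_ne_zero g hz σ)

/-- Weights add: `J_{k+k'}(g, z) = J_k(g, z) J_{k'}(g, z)` on `ℍ`. [cite: Freitag1990, Ch. I §4] -/
theorem autFactor_add (k k' : (F →+* ℝ) → ℤ) (g : SL(2, F)) {z : Point F} (hz : z ∈ halfSpace F) :
    autFactor (k + k') g z = autFactor k g z * autFactor k' g z := by
  rw [autFactor, autFactor, autFactor, ← Finset.prod_mul_distrib]
  exact Finset.prod_congr rfl fun σ _ ↦ by rw [Pi.add_apply, zpow_add₀ (denom_ne_zero g hz σ)]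

variable (F) in
/-- Holomorphy on `ℍ`: `ℂ`-Fréchet differentiability on the open subset `ℍ` of the `Pi` normed space
`ℂ^{Hom(F,ℝ)}` (a holomorphic function of `[F:ℚ]` complex variables). [cite: Freitag1990, Ch. I §4] -/
def IsHolomorphicOn (f : Point F → ℂ) : Prop :=
  DifferentiableOn ℂ f (halfSpace F)

variable (F) in
/-- Boundedness at the cusp `∞`: `f` is bounded on `{z ∈ ℍ : Im z_σ ≥ A for all σ}` for some `A`
(for a periodic holomorphic `f` this is regularity at `∞`, `a_ν ≠ 0 ⇒ ν ≥ 0`, Freitag I.4.3; for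
`F = ℚ` it is Mathlib's `IsBoundedAtImInfty`). [cite: Freitag1990, Ch. I Def. 4.3] -/
def IsBoundedAtInfty (f : Point F → ℂ) : Prop :=
  ∃ C A : ℝ, ∀ z ∈ halfSpace F, (∀ σ, A ≤ (z σ).im) → ‖f z‖ ≤ C

omit [NumberField F] in
/-- Sums of functions bounded at `∞` are bounded at `∞`. [folklore] -/
theorem IsBoundedAtInfty.add {f g : Point F → ℂ} (hf : IsBoundedAtInfty F f)
    (hg : IsBoundedAtInfty F g) : IsBoundedAtInfty F (f + g) := by
  obtain ⟨C, A, h⟩ := hf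
  obtain ⟨C', A', h'⟩ := hg
  refine ⟨C + C', max A A', fun z hz hA ↦ ?_⟩
  rw [Pi.add_apply]
  exact (norm_add_le _ _).trans (add_le_add (h z hz fun σ ↦ (le_max_left _ _).trans (hA σ))
    (h' z hz fun σ ↦ (le_max_right _ _).trans (hA σ)))

omit [NumberField F] in
/-- Scalar multiples of functions bounded at `∞` are bounded at `∞`. [folklore] -/
theorem IsBoundedAtInfty.const_mul {f : Point F → ℂ} (c : ℂ) (hf : IsBoundedAtInfty F f) :
    IsBoundedAtInfty F (fun z ↦ c * f z) := by
  obtain ⟨C, A, h⟩ := hf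
  refine ⟨‖c‖ * C, A, fun z hz hA ↦ ?_⟩
  rw [norm_mul]
  exact mul_le_mul_of_nonneg_left (h z hz hA) (norm_nonneg c)

omit [NumberField F] in
/-- Products of functions bounded at `∞` are bounded at `∞`. [folklore] -/
theorem IsBoundedAtInfty.mul {f g : Point F → ℂ} (hf : IsBoundedAtInfty F f)
    (hg : IsBoundedAtInfty F g) : IsBoundedAtInfty F (f * g) := by
  obtain ⟨C, A, h⟩ := hf
  obtain ⟨C', A', h'⟩ := hg
  refine ⟨C * C', max A A', fun z hz hA ↦ ?_⟩
  have h1 := h z hz fun σ ↦ (le_max_left _ _).trans (hA σ)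
  have h2 := h' z hz fun σ ↦ (le_max_right _ _).trans (hA σ)
  rw [Pi.mul_apply, norm_mul]
  exact mul_le_mul h1 h2 (norm_nonneg _) ((norm_nonneg _).trans h1)

omit [NumberField F] in
/-- The zero function is bounded at `∞`. [folklore] -/
theorem IsBoundedAtInfty.zero : IsBoundedAtInfty F (0 : Point F → ℂ) :=
  ⟨0, 0, fun z _ _ ↦ by simp⟩

/-- The slash action is additive in `f`. [folklore] -/
theorem slash_add (k : (F →+* ℝ) → ℤ) (g : SL(2, F)) (f f' : Point F → ℂ) :
    slash k g (f + f') = slash k g f + slash k g f' := by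
  ext z; simp [slash, mul_add]

/-- The slash action commutes with scalars. [folklore] -/
theorem slash_const_mul (k : (F →+* ℝ) → ℤ) (g : SL(2, F)) (c : ℂ) (f : Point F → ℂ) :
    slash k g (fun z ↦ c * f z) = fun z ↦ c * slash k g f z := by
  ext z; simp [slash]; ring

/-- The slash action of `0` is `0`. [folklore] -/
theorem slash_zero (k : (F →+* ℝ) → ℤ) (g : SL(2, F)) : slash k g (0 : Point F → ℂ) = 0 := by
  ext z; simp [slash]

/-- `(f f')|_{k+k'} g = (f|_k g)(f'|_{k'} g)` wherever `g z ∈ ℍ` is not needed: as an identity of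
junk-extended functions it holds at every `z` with `J(g,z) ≠ 0`, in particular on `ℍ`; we record the
pointwise form used for boundedness. [folklore] -/
theorem slash_mul_apply (k k' : (F →+* ℝ) → ℤ) (g : SL(2, F)) (f f' : Point F → ℂ) {z : Point F}
    (hz : z ∈ halfSpace F) :
    slash (k + k') g (f * f') z = slash k g f z * slash k' g f' z := by
  simp only [slash, Pi.mul_apply, autFactor_add k k' g hz, mul_inv]
  ring

/-- **Hilbert modular forms** of weight `k = (k_σ)_σ ∈ ℤ^{Hom(F,ℝ)}` and level a subgroup
`Γ ≤ SL₂(𝓞 F)`, as a predicate on functions `f` on the ambient space `ℂ^{Hom(F,ℝ)}`: `f` is holomorphic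
on `ℍ`; `f(γ z) = J_k(γ, z) f(z)` for `γ ∈ Γ`, `z ∈ ℍ` (Freitag I.4.5 a), there for even weights
`k = 2r`; general integral `k` with trivial multiplier, p. 44); `f` is regular at every cusp — `f|_k g`
is bounded at `∞` for every `g ∈ SL₂(F)` (Freitag I.4.5 b) with I.4.3–4.4 and `G = SL(2, K)`;
redundant when `[F:ℚ] ≥ 2` by Götzky–Koecher, I.4.9 Cor.); and — a normalisation of junk values —
`f` vanishes off `ℍ`.  Typical use: `Γ = Bianchi.Gamma1 𝔫`, `F` totally real. [cite: Freitag1990, Ch. I Def. 4.5] -/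
structure IsModularForm (Γ : Subgroup SL(2, 𝓞 F)) (k : (F →+* ℝ) → ℤ) (f : Point F → ℂ) : Prop where
  holomorphic : IsHolomorphicOn F f
  transform : ∀ γ ∈ Γ, ∀ z ∈ halfSpace F, f (moeb (toSL2F γ) z) = autFactor k (toSL2F γ) z * f z
  bounded_at_cusps : ∀ g : SL(2, F), IsBoundedAtInfty F (slash k g f)
  eq_zero : ∀ z ∉ halfSpace F, f z = 0

/-- The `ℂ`-vector space `M_k(Γ)` of Hilbert modular forms of weight `k` and level `Γ ≤ SL₂(𝓞 F)`
(Freitag's `[Γ, 2r]` for `k = 2r`), as a submodule of all functions on the ambient space.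
[cite: Freitag1990, Ch. I Def. 4.5] -/
def modularForms (Γ : Subgroup SL(2, 𝓞 F)) (k : (F →+* ℝ) → ℤ) : Submodule ℂ (Point F → ℂ) where
  carrier := {f | IsModularForm Γ k f}
  zero_mem' := ⟨differentiableOn_const 0, fun γ _ z _ ↦ by simp,
    fun g ↦ by rw [slash_zero]; exact IsBoundedAtInfty.zero, fun z _ ↦ rfl⟩
  add_mem' {f g} hf hg :=
    ⟨DifferentiableOn.add hf.holomorphic hg.holomorphic, fun γ hγ z hz ↦ by
      rw [Pi.add_apply, Pi.add_apply, hf.transform γ hγ z hz, hg.transform γ hγ z hz]; ring,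
      fun g' ↦ by rw [slash_add]; exact (hf.bounded_at_cusps g').add (hg.bounded_at_cusps g'),
      fun z hz ↦ by rw [Pi.add_apply, hf.eq_zero z hz, hg.eq_zero z hz, add_zero]⟩
  smul_mem' c f hf :=
    ⟨DifferentiableOn.const_smul hf.holomorphic c, fun γ hγ z hz ↦ by
      rw [Pi.smul_apply, Pi.smul_apply, smul_eq_mul, smul_eq_mul, hf.transform γ hγ z hz]; ring,
      fun g' ↦ by
        have : c • f = fun z ↦ c * f z := by ext z; simp
        rw [this, slash_const_mul]
        exact (hf.bounded_at_cusps g').const_mul c,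
      fun z hz ↦ by rw [Pi.smul_apply, smul_eq_mul, hf.eq_zero z hz, mul_zero]⟩

/-- Membership in `M_k(Γ)` is the predicate `IsModularForm`. [cite: Freitag1990, Ch. I Def. 4.5] -/
theorem mem_modularForms_iff {Γ : Subgroup SL(2, 𝓞 F)} {k : (F →+* ℝ) → ℤ} {f : Point F → ℂ} :
    f ∈ modularForms Γ k ↔ IsModularForm Γ k f :=
  Iff.rfl

/-- **Products of Hilbert modular forms**: `M_k(Γ) · M_{k'}(Γ) ⊆ M_{k+k'}(Γ)`. [cite: Freitag1990, Ch. I §4] -/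
theorem IsModularForm.mul {Γ : Subgroup SL(2, 𝓞 F)} {k k' : (F →+* ℝ) → ℤ} {f g : Point F → ℂ}
    (hf : IsModularForm Γ k f) (hg : IsModularForm Γ k' g) : IsModularForm Γ (k + k') (f * g) where
  holomorphic := DifferentiableOn.mul hf.holomorphic hg.holomorphic
  transform γ hγ z hz := by
    have h1 := hf.transform γ hγ z hz
    have h2 := hg.transform γ hγ z hz
    have h3 := autFactor_add k k' (toSL2F γ) hz
    simp only [Pi.mul_apply, h1, h2, h3]
    ring
  bounded_at_cusps g' := by
    obtain ⟨C, A, h⟩ := hf.bounded_at_cusps g'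
    obtain ⟨C', A', h'⟩ := hg.bounded_at_cusps g'
    refine ⟨C * C', max A A', fun z hz hA ↦ ?_⟩
    have h1 := h z hz fun σ ↦ (le_max_left _ _).trans (hA σ)
    have h2 := h' z hz fun σ ↦ (le_max_right _ _).trans (hA σ)
    rw [slash_mul_apply k k' g' f g hz, norm_mul]
    exact mul_le_mul h1 h2 (norm_nonneg _) ((norm_nonneg _).trans h1)
  eq_zero z hz := by rw [Pi.mul_apply, hf.eq_zero z hz, zero_mul]

/-- Products, submodule form. [cite: Freitag1990, Ch. I §4] -/
theorem mul_mem_modularForms {Γ : Subgroup SL(2, 𝓞 F)} {k k' : (F →+* ℝ) → ℤ} {f g : Point F → ℂ}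
    (hf : f ∈ modularForms Γ k) (hg : g ∈ modularForms Γ k') : f * g ∈ modularForms Γ (k + k') :=
  IsModularForm.mul hf hg

/-- A smaller level gives a larger space: `Γ' ≤ Γ ⇒ M_k(Γ) ⊆ M_k(Γ')`. [cite: Freitag1990, Ch. I Rem. 4.5₁] -/
theorem modularForms_mono {Γ Γ' : Subgroup SL(2, 𝓞 F)} (h : Γ' ≤ Γ) (k : (F →+* ℝ) → ℤ) :
    modularForms Γ k ≤ modularForms Γ' k := fun _ hf ↦
  ⟨hf.holomorphic, fun γ hγ z hz ↦ hf.transform γ (h hγ) z hz, hf.bounded_at_cusps, hf.eq_zero⟩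

end Analytic

/-! ## §3 Fourier coefficients and `q`-expansions at the cusp `∞` -/

section QExpansion

variable (F : Type*) [Field F] [NumberField F]

/-- Real coordinates on `F ⊗ ℝ = ℝ^{Hom(F,ℝ)}`: one real coordinate per element of the integral basis
`b = NumberField.integralBasis F` of `𝓞 F`. [folklore] -/
abbrev Coord : Type _ := Module.Free.ChooseBasisIndex ℤ (𝓞 F) → ℝ

variable {F}

/-- The real point `x = ∑_i x_i b_i ∈ F ⊗ ℝ`, coordinatewise `x_σ = ∑_i x_i σ(b_i)`; as `x` ranges
over the unit cube, this ranges over a fundamental parallelotope `P` of the translation lattice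
`𝓞 F ⊆ ℝ^{Hom(F,ℝ)}`. [cite: Freitag1990, Ch. I Lemma 4.1] -/
noncomputable def realPoint (x : Coord F) (σ : F →+* ℝ) : ℝ :=
  ∑ i, x i * σ (integralBasis F i)

/-- The point `x + iy` of the tube domain with real part `realPoint x` and imaginary part `y`.
[cite: Freitag1990, Ch. I Lemma 4.1] -/
noncomputable def cubePoint (x : Coord F) (y : (F →+* ℝ) → ℝ) : Point F := fun σ ↦
  ((realPoint x σ : ℝ) : ℂ) + ((y σ : ℝ) : ℂ) * Complex.I

/-- The pairing `S(νz) = ∑_σ σ(ν) z_σ` (so that `q^ν = e^{2πi S(νz)}`). [cite: Freitag1990, Ch. I Lemma 4.1] -/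
noncomputable def pairing (ν : F) (z : Point F) : ℂ :=
  ∑ σ : F →+* ℝ, ((σ ν : ℝ) : ℂ) * z σ

/-- The `ν`-th Fourier coefficient of an `𝓞 F`-periodic function `f` on the tube domain, computed at
height `y`: `a_ν(y) = ∫_{[0,1]^{[F:ℚ]}} f(x + iy) e^{-2πi S(ν(x + iy))} dx` in integral-basis coordinates
(Freitag's `a_g = vol(P)⁻¹ ∫_P f(z) e^{-2πi S(gz)} dx`; the unit cube is a fundamental parallelotope of
volume `1` in these coordinates).  For holomorphic `f` it is independent of `y ≫ 0` (Freitag I.4.1, a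
theorem not stated here); for non-periodic `f` the value is junk. [cite: Freitag1990, Ch. I Lemma 4.1] -/
noncomputable def fourierCoeffAt (f : Point F → ℂ) (ν : F) (y : (F →+* ℝ) → ℝ) : ℂ :=
  ∫ x in Set.Icc (0 : Coord F) 1,
    f (cubePoint x y) * Complex.exp (-(2 * Real.pi * Complex.I * pairing ν (cubePoint x y)))

/-- The `ν`-th Fourier coefficient at the standard height `y = (1, …, 1)`:
`a_ν = ∫_{[0,1]^{[F:ℚ]}} f(x + i·1) e^{-2πi S(ν(x + i·1))} dx`. [cite: Freitag1990, Ch. I Lemma 4.1] -/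
noncomputable def fourierCoeff (f : Point F → ℂ) (ν : F) : ℂ :=
  fourierCoeffAt f ν fun _ ↦ 1

/-- Unfolding of `fourierCoeff`. [folklore] -/
theorem fourierCoeff_eq (f : Point F → ℂ) (ν : F) : fourierCoeff f ν = fourierCoeffAt f ν fun _ ↦ 1 :=
  rfl

variable (F) in
/-- The index set of `q`-expansions at `∞` of `𝓞 F`-periodic forms: `ν` in the dual lattice
`𝔡⁻¹ = {ν : Tr_{F/ℚ}(ν a) ∈ ℤ for all a ∈ 𝓞 F}` of the translation lattice `𝓞 F` (Freitag's `t⁰`)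
with `ν = 0` or `ν` totally positive (regularity at `∞`, Freitag I.4.3: `a_ν ≠ 0 ⇒ ν ≥ 0`, and
`ν ≥ 0, ν ≠ 0 ⇒ ν ≫ 0` for field elements, I.4.2). [cite: Freitag1990, Ch. I Def. 4.3] -/
def qIndexSet : Set F :=
  {ν | (∀ a : 𝓞 F, ∃ n : ℤ, Algebra.trace ℚ F (ν * a) = n) ∧ (ν = 0 ∨ ∀ σ : F →+* ℝ, 0 < σ ν)}

/-- Membership in the `q`-expansion index set. [cite: Freitag1990, Ch. I Def. 4.3] -/
theorem mem_qIndexSet_iff {ν : F} :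
    ν ∈ qIndexSet F ↔
      (∀ a : 𝓞 F, ∃ n : ℤ, Algebra.trace ℚ F (ν * a) = n) ∧ (ν = 0 ∨ ∀ σ : F →+* ℝ, 0 < σ ν) :=
  Iff.rfl

/-- `0` lies in the index set. [folklore] -/
theorem zero_mem_qIndexSet : (0 : F) ∈ qIndexSet F :=
  ⟨fun _ ↦ ⟨0, by simp⟩, Or.inl rfl⟩

/-- The `q`-expansion `ν ↦ a_ν` of `f` at the cusp `∞`, as a function on all of `F` extended by `0` off
the index set `qIndexSet F` (formal series `∑_{ν ∈ {0} ∪ 𝔡⁻¹₊} a_ν q^ν`). [cite: Freitag1990, Ch. I Lemma 4.1, Def. 4.3] -/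
noncomputable def qExpansion (f : Point F → ℂ) : F → ℂ :=
  (qIndexSet F).indicator (fourierCoeff f)

/-- On the index set the `q`-expansion is the Fourier coefficient. [folklore] -/
theorem qExpansion_of_mem {f : Point F → ℂ} {ν : F} (hν : ν ∈ qIndexSet F) :
    qExpansion f ν = fourierCoeff f ν :=
  Set.indicator_of_mem hν _

/-- Off the index set the `q`-expansion vanishes (by definition). [folklore] -/
theorem qExpansion_of_not_mem {f : Point F → ℂ} {ν : F} (hν : ν ∉ qIndexSet F) : qExpansion f ν = 0 :=
  Set.indicator_of_notMem hν _

/-- The Fourier coefficient is `ℂ`-linear in `f`: additivity. [folklore] -/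
theorem fourierCoeffAt_add {f g : Point F → ℂ} (ν : F) (y : (F →+* ℝ) → ℝ)
    (hf : IntegrableOn (fun x : Coord F ↦
      f (cubePoint x y) * Complex.exp (-(2 * Real.pi * Complex.I * pairing ν (cubePoint x y))))
      (Set.Icc 0 1))
    (hg : IntegrableOn (fun x : Coord F ↦
      g (cubePoint x y) * Complex.exp (-(2 * Real.pi * Complex.I * pairing ν (cubePoint x y))))
      (Set.Icc 0 1)) :
    fourierCoeffAt (f + g) ν y = fourierCoeffAt f ν y + fourierCoeffAt g ν y := by
  simp only [fourierCoeffAt, Pi.add_apply, add_mul]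
  exact integral_add hf hg

/-- The Fourier coefficient is `ℂ`-linear in `f`: homogeneity. [folklore] -/
theorem fourierCoeffAt_const_mul (c : ℂ) (f : Point F → ℂ) (ν : F) (y : (F →+* ℝ) → ℝ) :
    fourierCoeffAt (fun z ↦ c * f z) ν y = c * fourierCoeffAt f ν y := by
  simp only [fourierCoeffAt, mul_assoc]
  exact integral_const_mul c _

end QExpansion

end HilbertModular

end Literature.NumberTheory.Automorphic
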